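/-
Copyright (c) 2026 the pub-hodgecm-mathlib formalisation cell (harness21).  Prover seat hodgecm-mathlib-K2E4-p23 (g2), Track B ∕ K2-LIT, h413 =
`stmt-HodgeConjecture-24833`, ENGINE E1, 5Res campaign, (113)∕hmc second half (dealer K2E1-plan (g7) (126)), part 2a: `s ↦ Φ_{s,m}(a)` IS ENTIRE (needed to continue the
circle-average identity ★ (113)(iii) in `z` by the identity theorem).
-/
import Summits.HodgeConjecture.HodgeConjecture.Theorems.K2E1ArchTorusActionEisensteinU11   -- ★ p859792 (this seat): `continuous_archTorusIntegrand`; brings F2a `archTorusIntegrand`, `archTorusCoeff`, `torusW`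
import Mathlib.Analysis.Calculus.ParametricIntervalIntegral
import Mathlib.Analysis.SpecialFunctions.Pow.Deriv
import HarnessLib

/-!
# K2·E1 — `K2E1ArchTorusCoefficientHolomorphicU11`: THE TORUS MATRIX COEFFICIENT `Φ_{s,m}(a) = archTorusCoeff s m a` IS AN ENTIRE FUNCTION OF `s`
# ((113)∕hmc second half, part 2a — differentiation under the integral sign)

Track B ∕ K2-LIT, crux h413 = `stmt-HodgeConjecture-24833`, route of record `HCCMUnconditional`; cell `hodgecm-mathlib`, squad K2, ENGINE E1 (5Res campaign, ARCH-UNITARITY leg).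
Prover seat `hodgecm-mathlib-K2E4-p23` (g2).  THEOREMS ONLY (no `def`, no `instance`, no notation, no named-fact hypothesis, no `sorry`); lane `--supports stmt-HodgeConjecture-24833
--as helper` (count-neutral).  CLOSES NO SOCKET.

WHAT.  For `a > 0`, `m ∈ ℤ`: `archTorusIntegrand s m a θ = (|W_a(θ)|²∕4)^{−s}·(W_a(θ)∕|W_a(θ)|)^m` is entire in `s` for each `θ` with `∂_s = −log(|W|²∕4)·(integrand)`
(`hasDerivAt_archTorusIntegrand_param`), the derivative is jointly continuous in `(s, θ)` (`continuous_archTorusIntegrandDeriv₂`), hence bounded on `closedBall s₀ 1 × [0, 2π]`, so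
Mathlib's `intervalIntegral.hasDerivAt_integral_of_dominated_loc_of_deriv_le` differentiates under `∫₀^{2π}`: **`hasDerivAt_intervalIntegral_archTorusIntegrand_param`**,
**`differentiable_archTorusCoeff_param : Differentiable ℂ (fun s => archTorusCoeff s m a)`**.  USE ((113)∕hmc part 2b): the identity ★ `circleAverage_torusAt_eisensteinSeriesU_eq_archTorusCoeff_mul`
(`Re z > 1`, `s = z + it_w`) has BOTH sides meromorphic in `z` once `E(f_z)` is continued (row 13 ★ `K2E1ChiEisensteinMeromorphicU2`), so it persists to the whole plane and to residues.
HONEST LABEL: HC_CM is proved only modulo the 7 printed citations (2 remaining named inputs: hLiu418 = `stmt-HodgeConjecture-24832`, h413 = `stmt-HodgeConjecture-24833`) until rung 0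
closes; this file asserts no named fact and closes no socket; count-neutral.

## References
* [Knapp1986] A. W. Knapp, *Representation Theory of Semisimple Groups* (1986), VII §1 (matrix coefficients of the principal series are entire in the parameter).
* [Folland1995] G. B. Folland, *Real Analysis* ∕ *A Course in Abstract Harmonic Analysis* (1995), differentiation under the integral sign.
-/

set_option autoImplicit false
-- the mandated namespace repeats the single-problem summit's segment (`HodgeConjecture.HodgeConjecture`)
set_option linter.dupNamespace false

noncomputable section

open MeasureTheory intervalIntegral Metric Set
open scoped Real Topology
open Summit.HodgeConjecture.HodgeConjecture.Cruxes.H413.K2E1ArchTorusCoefficientU11Defs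
open Summit.HodgeConjecture.HodgeConjecture.Cruxes.H413.K2E1ArchTorusActionEisensteinU11 (continuous_archTorusIntegrand)

namespace Summit.HodgeConjecture.HodgeConjecture.Cruxes.H413.K2E1ArchTorusCoefficientHolomorphicU11

/-! ## §1 The base `|W|²∕4` and the `s`-derivative of the integrand -/

/-- The base `|W_a(θ)|²∕4` is a positive real (`a > 0`). [folklore] -/
theorem base_pos {a : ℝ} (ha : 0 < a) (θ : ℝ) : 0 < Complex.normSq (torusW a θ) / 4 := by
  have := Complex.normSq_pos.2 (torusW_ne_zero ha θ); positivity

/-- The base, cast to `ℂ`, lies in the slit plane. [folklore] -/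
theorem base_mem_slitPlane {a : ℝ} (ha : 0 < a) (θ : ℝ) : (((Complex.normSq (torusW a θ) / 4 : ℝ)) : ℂ) ∈ Complex.slitPlane :=
  Complex.ofReal_mem_slitPlane.2 (base_pos ha θ)

/-- The base, cast to `ℂ`, is nonzero. [folklore] -/
theorem base_ne_zero {a : ℝ} (ha : 0 < a) (θ : ℝ) : (((Complex.normSq (torusW a θ) / 4 : ℝ)) : ℂ) ≠ 0 :=
  Complex.ofReal_ne_zero.2 (base_pos ha θ).ne'

/-- `θ ↦ |W_a(θ)|²∕4` (cast to `ℂ`) is continuous. [folklore] -/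
theorem continuous_base (a : ℝ) : Continuous fun θ : ℝ => (((Complex.normSq (torusW a θ) / 4 : ℝ)) : ℂ) :=
  Complex.continuous_ofReal.comp ((Complex.continuous_normSq.comp (continuous_torusW a)).div_const _)

/-- **`∂_s archTorusIntegrand s m a θ = −log(|W|²∕4) · archTorusIntegrand s m a θ`** (the base is a positive real, `(c)^{−s} = e^{−s log c}`). [cite: Knapp1986, VII §1] -/
theorem hasDerivAt_archTorusIntegrand_param (m : ℤ) {a : ℝ} (ha : 0 < a) (θ : ℝ) (s : ℂ) :
    HasDerivAt (fun s : ℂ => archTorusIntegrand s m a θ)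
      (-Complex.log (((Complex.normSq (torusW a θ) / 4 : ℝ)) : ℂ) * archTorusIntegrand s m a θ) s := by
  have hc := base_ne_zero ha θ
  have h1 : HasDerivAt (fun s : ℂ => (((Complex.normSq (torusW a θ) / 4 : ℝ)) : ℂ) ^ (-s))
      ((((Complex.normSq (torusW a θ) / 4 : ℝ)) : ℂ) ^ (-s) * Complex.log (((Complex.normSq (torusW a θ) / 4 : ℝ)) : ℂ) * (-1)) s := by
    have h := (Complex.hasStrictDerivAt_const_cpow (x := (((Complex.normSq (torusW a θ) / 4 : ℝ)) : ℂ)) (y := -s) (Or.inl hc)).hasDerivAt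
    exact h.comp s (hasDerivAt_neg s)
  have h2 := h1.mul_const ((torusW a θ / (‖torusW a θ‖ : ℂ)) ^ m)
  refine h2.congr_deriv ?_
  simp only [archTorusIntegrand]
  ring

/-- The `s`-derivative `(s, θ) ↦ −log(|W_a(θ)|²∕4)·archTorusIntegrand s m a θ` is jointly continuous. [folklore] -/
theorem continuous_archTorusIntegrandDeriv₂ (m : ℤ) {a : ℝ} (ha : 0 < a) :
    Continuous fun p : ℂ × ℝ => -Complex.log (((Complex.normSq (torusW a p.2) / 4 : ℝ)) : ℂ) * archTorusIntegrand p.1 m a p.2 := by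
  have hW : Continuous fun p : ℂ × ℝ => torusW a p.2 := (continuous_torusW a).comp continuous_snd
  have hb : Continuous fun p : ℂ × ℝ => (((Complex.normSq (torusW a p.2) / 4 : ℝ)) : ℂ) := (continuous_base a).comp continuous_snd
  refine ((hb.clog fun p => base_mem_slitPlane ha p.2).neg).mul ?_
  unfold archTorusIntegrand
  refine (hb.cpow continuous_fst.neg fun p => base_mem_slitPlane ha p.2).mul ?_
  have hn : ∀ p : ℂ × ℝ, ((‖torusW a p.2‖ : ℝ) : ℂ) ≠ 0 := fun p => Complex.ofReal_ne_zero.2 (norm_ne_zero_iff.2 (torusW_ne_zero ha p.2))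
  exact (hW.div (Complex.continuous_ofReal.comp hW.norm) hn).zpow₀ m fun p => Or.inl (div_ne_zero (torusW_ne_zero ha p.2) (hn p))

/-! ## §2 Differentiation under `∫₀^{2π}` -/

/-- **DIFFERENTIATION UNDER THE INTEGRAL SIGN**: `s ↦ ∫₀^{2π} archTorusIntegrand s m a θ dθ` has derivative `∫₀^{2π} (−log(|W|²∕4)·archTorusIntegrand s m a θ) dθ` at every `s`
(derivative bounded on `closedBall s 1 × [0, 2π]` by joint continuity and compactness). [cite: Knapp1986, VII §1] -/
theorem hasDerivAt_intervalIntegral_archTorusIntegrand_param (m : ℤ) {a : ℝ} (ha : 0 < a) (s₀ : ℂ) :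
    HasDerivAt (fun s : ℂ => ∫ θ in (0 : ℝ)..2 * π, archTorusIntegrand s m a θ)
      (∫ θ in (0 : ℝ)..2 * π, -Complex.log (((Complex.normSq (torusW a θ) / 4 : ℝ)) : ℂ) * archTorusIntegrand s₀ m a θ) s₀ := by
  have hF'c := continuous_archTorusIntegrandDeriv₂ m ha
  -- a uniform bound for the derivative on `closedBall s₀ 1 × [0, 2π]`
  obtain ⟨C, hC⟩ := ((isCompact_closedBall s₀ 1).prod (isCompact_uIcc (a := (0 : ℝ)) (b := 2 * π))).exists_bound_of_continuousOn hF'c.continuousOn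
  refine (intervalIntegral.hasDerivAt_integral_of_dominated_loc_of_deriv_le (μ := volume) (a := (0 : ℝ)) (b := 2 * π) (x₀ := s₀)
    (F := fun (s : ℂ) (θ : ℝ) => archTorusIntegrand s m a θ)
    (F' := fun (s : ℂ) (θ : ℝ) => -Complex.log (((Complex.normSq (torusW a θ) / 4 : ℝ)) : ℂ) * archTorusIntegrand s m a θ)
    (bound := fun _ => C) (ball_mem_nhds s₀ one_pos) ?_ ?_ ?_ ?_ intervalIntegrable_const ?_).2
  · exact Filter.Eventually.of_forall fun s => (continuous_archTorusIntegrand s m ha).aestronglyMeasurable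
  · exact (continuous_archTorusIntegrand s₀ m ha).intervalIntegrable _ _
  · exact (hF'c.comp (Continuous.prodMk_right s₀)).aestronglyMeasurable
  · refine Filter.Eventually.of_forall fun θ hθ s hs => ?_
    exact hC (s, θ) ⟨mem_closedBall.2 (le_of_lt (mem_ball.1 hs)), uIoc_subset_uIcc hθ⟩
  · exact Filter.Eventually.of_forall fun θ _ s _ => hasDerivAt_archTorusIntegrand_param m ha θ s

/-- `s ↦ ∫₀^{2π} archTorusIntegrand s m a θ dθ` is entire. [cite: Knapp1986, VII §1] -/
theorem differentiable_intervalIntegral_archTorusIntegrand_param (m : ℤ) {a : ℝ} (ha : 0 < a) :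
    Differentiable ℂ fun s : ℂ => ∫ θ in (0 : ℝ)..2 * π, archTorusIntegrand s m a θ :=
  fun s => (hasDerivAt_intervalIntegral_archTorusIntegrand_param m ha s).differentiableAt

/-- **`Φ_{·,m}(a)` IS ENTIRE**: `Differentiable ℂ (fun s => archTorusCoeff s m a)` for `a > 0`. [cite: Knapp1986, VII §1] -/
theorem differentiable_archTorusCoeff_param (m : ℤ) {a : ℝ} (ha : 0 < a) : Differentiable ℂ fun s : ℂ => archTorusCoeff s m a := by
  have h := (differentiable_intervalIntegral_archTorusIntegrand_param m ha).const_smul ((2 * π)⁻¹ : ℝ)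
  have he : (fun s : ℂ => archTorusCoeff s m a) = fun s : ℂ => ((2 * π)⁻¹ : ℝ) • ∫ θ in (0 : ℝ)..2 * π, archTorusIntegrand s m a θ :=
    funext fun s => archTorusCoeff_def s m a
  rw [he]
  exact h

end Summit.HodgeConjecture.HodgeConjecture.Cruxes.H413.K2E1ArchTorusCoefficientHolomorphicU11

end
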